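import Summits.Ventures.PercRepro.ExcessOneWitnessDirection

/-!
# Theorem (MA-i, no K–K pair), part I: the setting and the uniqueness of the non-lifted member

Setting (proofs/MINE1-theoremS.md, Addendum 26): `F` has Marica–Schönheim excess one, `{r} ∈ F`,
the trace `proj r F` is tight, `∅ ∉ F`, `{b} ∉ F`; `x ∈ F₀ \ F₁`, `b ∉ x`, `insert b x ∈ K` (a
`(P₀, K)` witness) and no partner member `e` has `insert b e` a partner member (no `K`–`K`
`b`-pair). This module proves:

* `lam_eq_singleton_empty_of_no_partner_pair`: `Λ_b = {∅}` (the trace identity at `b`);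
* `mem_partr_or_insert_mem_partr_of_witness` (**(W2′ c)**): every face `e ∌ b` is `r`-lifted or
  has `insert b e` `r`-lifted — Lemma B for the tight projection `proj b F`
  (`tight_proj_of_witness`, `insert_mem_of_card_le`, `dichotomy_of_tight`);
* `A26Data.eq_x_of_partnerless` (the hypotheses are listed explicitly, in the namespace `A26Data`):
  **`x` is the only member avoiding `r` without its `r`-partner** (`P₀ = {x}`), by the two-step
  descent `p ↦ p \ x` for a partnerless `p ∋ b`;
* `A26Data.partner_mem_b_cases`: a partner member containing `b` is `insert b x` or has an
  `r`-only `b`-deletion lying inside every member of `F₀` avoiding `b`.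

Part II (`ExcessOneNoPartnerPair`) proves that every partner member meets `x` and that `x`
completes `F`.
-/

namespace PercRepro.MSTight

open Finset
open scoped FinsetFamily

variable {α : Type*} [DecidableEq α] [Fintype α]

section NoPartnerPair

variable {F : Finset (Finset α)} {r b : α}

/-- With no `K`–`K` `b`-pair, the `b`-pairs of `Y` reduce to `{∅}` at a witness: `Λ_b = {∅}`. -/
theorem lam_eq_singleton_empty_of_no_partner_pair (hF : (F \\ F).card = F.card + 1)
    (hP : Tight (proj r F)) (hr : ({r} : Finset α) ∈ F) {x : Finset α}
    (hx0 : x ∈ part0 r F) (hbx : b ∉ x) (hxb1 : insert b x ∈ partr r F)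
    (hL : ∀ e ∈ partner r F, insert b e ∉ partner r F) :
    ((diffsY r F).filter fun y => b ∉ y ∧ insert b y ∈ diffsY r F) = {∅} := by
  have hbr : b ≠ r := by
    rintro rfl
    exact (mem_partr.1 hxb1).1 (mem_insert_self b x)
  have hX : diffsX r F = proj r F := diffsX_eq_proj_of_singleton_mem hP hr
  set lk := (proj r F).filter fun e => b ∉ e ∧ insert b e ∈ proj r F with hlk
  set lam := (diffsY r F).filter fun y => b ∉ y ∧ insert b y ∈ diffsY r F with hlam
  set L0 := (part0 r F).filter fun s => b ∉ s ∧ insert b s ∈ part0 r F with hL0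
  set L1 := (partr r F).filter fun t => b ∉ t ∧ insert b t ∈ partr r F with hL1
  -- `L₀ ∩ L₁ = ∅`
  have hL01 : L0 ∩ L1 = ∅ := by
    rw [eq_empty_iff_forall_notMem]
    intro e he
    rw [mem_inter, hL0, hL1, mem_filter, mem_filter] at he
    exact hL e (mem_inter.2 ⟨he.1.1, he.2.1⟩) (mem_inter.2 ⟨he.1.2.2, he.2.2.2⟩)
  have hA : lk.card + lam.card ≤ (diffsX b F ∩ diffsY b F).card := card_lk_add_card_lam_le hbr hX
  have hB : (diffsX b F ∩ diffsY b F).card ≤ (partner b F).card + 1 :=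
    card_diffsX_inter_diffsY_le_of_card_diffs_eq b hF
  have hC : (partner b F).card ≤ L0.card + L1.card := card_partner_le_card_L0_add_card_L1 hbr
  have hD : (L0 ∪ L1).card ≤ lk.card := by
    apply card_le_card
    apply union_subset
    · intro s hs
      rw [hL0, mem_filter] at hs
      rw [hlk, mem_filter, proj_eq_union]
      exact ⟨mem_union_left _ hs.1, hs.2.1, mem_union_left _ hs.2.2⟩
    · intro t ht
      rw [hL1, mem_filter] at ht
      rw [hlk, mem_filter, proj_eq_union]
      exact ⟨mem_union_right _ ht.1, ht.2.1, mem_union_right _ ht.2.2⟩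
  have hE : (L0 ∪ L1).card + (L0 ∩ L1).card = L0.card + L1.card := card_union_add_card_inter L0 L1
  rw [hL01, card_empty] at hE
  have hlam1 : lam.card ≤ 1 := by omega
  -- `∅ ∈ Λ_b`
  have h0Y : (∅ : Finset α) ∈ partr r F := mem_partr.2 ⟨notMem_empty r, by simpa using hr⟩
  have h0 : (∅ : Finset α) ∈ lam := by
    rw [hlam, mem_filter]
    refine ⟨?_, notMem_empty b, ?_⟩
    · have h := sdiff_mem_diffs h0Y hx0
      rw [Finset.empty_sdiff] at h
      exact h
    · have : insert b x \ x = insert b (∅ : Finset α) := by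
        rw [Finset.insert_sdiff_of_notMem x hbx, sdiff_self]; rfl
      rw [← this]; exact sdiff_mem_diffs hxb1 hx0
  exact (eq_of_subset_of_card_le (singleton_subset_iff.2 h0) (by rw [card_singleton]; exact hlam1)).symm

/-- **(W2′ c)** when `∅ ∉ F` and `{b} ∉ F`: at a witness direction every face `e ∌ b` is
`r`-lifted or has its `b`-extension `r`-lifted (Lemma B for the tight projection along `b`). -/
theorem mem_partr_or_insert_mem_partr_of_witness (hF : (F \\ F).card = F.card + 1)
    (hP : Tight (proj r F)) (hr : ({r} : Finset α) ∈ F) (hE : (∅ : Finset α) ∉ F)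
    (hb0 : ({b} : Finset α) ∉ F) {x : Finset α}
    (hx0 : x ∈ part0 r F) (hbx : b ∉ x) (hxb1 : insert b x ∈ partr r F)
    (hwit : ¬ (x ∈ partr r F ∧ insert b x ∈ part0 r F)) {e : Finset α} (he : e ∈ proj r F)
    (hbe : b ∉ e) : e ∈ partr r F ∨ insert b e ∈ partr r F := by
  have hbr : b ≠ r := by
    rintro rfl
    exact (mem_partr.1 hxb1).1 (mem_insert_self b x)
  have hG : Tight (proj b F) := tight_proj_of_witness hF hP hr hx0 hbx hxb1 hwit
  -- `{r} ∈ G`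
  have hrG : ({r} : Finset α) ∈ proj b F :=
    mem_proj.2 ⟨{r}, hr, by rw [erase_eq_of_notMem]; simpa using hbr⟩
  -- the partner family of `G` at `r` is nonempty: `x`
  have hxG : x ∈ partner r (proj b F) := by
    refine mem_inter.2 ⟨mem_part0.2 ⟨?_, (mem_part0.1 hx0).2⟩, mem_partr.2 ⟨(mem_part0.1 hx0).2, ?_⟩⟩
    · exact mem_proj.2 ⟨x, (mem_part0.1 hx0).1, erase_eq_of_notMem hbx⟩
    · refine mem_proj.2 ⟨insert b (insert r x), ?_, ?_⟩
      · rw [Finset.insert_comm]; exact (mem_partr.1 hxb1).2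
      · rw [erase_insert]
        rw [mem_insert]; rintro (h | h); exact hbr h; exact hbx h
  have hdich := dichotomy_of_tight (tight_proj_and_partner (r := r) hG).2.1
  -- the card comparison: `|G₀| ≤ |G₁|`, else `∅ ∈ G` via Lemma B's first half
  have hcard : (part0 r (proj b F)).card ≤ (partr r (proj b F)).card := by
    by_contra hlt
    have hle : (partr r (proj b F)).card ≤ (part0 r (proj b F)).card := by omega
    have h := erase_mem_of_card_le hG ⟨x, hxG⟩ hle hdich {r} hrG (mem_singleton_self r)
    rw [erase_singleton] at h
    obtain ⟨B, hB, hBe⟩ := mem_proj.1 h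
    -- `B.erase b = ∅` forces `B = ∅` or `B = {b}`
    have : B ⊆ {b} := by
      intro a ha
      rw [mem_singleton]
      by_contra hab
      have : a ∈ B.erase b := mem_erase.2 ⟨hab, ha⟩
      rw [hBe] at this
      exact notMem_empty a this
    rcases subset_singleton_iff.1 this with h1 | h1
    · exact hE (h1 ▸ hB)
    · exact hb0 (h1 ▸ hB)
  have hlift := insert_mem_of_card_le hG ⟨x, hxG⟩ hcard hdich
  -- apply to `e ∈ G`
  rw [proj_eq_union, mem_union] at he
  rcases he with he0 | he1
  · have heG : e ∈ proj b F := mem_proj.2 ⟨e, (mem_part0.1 he0).1, erase_eq_of_notMem hbe⟩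
    have := hlift e heG (mem_part0.1 he0).2
    obtain ⟨B, hB, hBe⟩ := mem_proj.1 this
    -- `B.erase b = insert r e`, so `B = insert r e` or `B = insert b (insert r e)`
    by_cases hbB : b ∈ B
    · right
      have hB' : B = insert b (insert r e) := by
        rw [← hBe, insert_erase hbB]
      rw [hB', Finset.insert_comm] at hB
      exact mem_partr.2 ⟨by rw [mem_insert]; rintro (h | h); exact hbr h.symm; exact (mem_part0.1 he0).2 h, hB⟩
    · left
      rw [erase_eq_of_notMem hbB] at hBe
      rw [hBe] at hB
      exact mem_partr.2 ⟨(mem_part0.1 he0).2, hB⟩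
  · left; exact he1

end NoPartnerPair

section UniquePartnerless

variable {F : Finset (Finset α)} {r b : α}


namespace A26Data

variable {x : Finset α}

omit [Fintype α] in
/-- `b ≠ r`. -/
theorem hbr (_hF : (F \\ F).card = F.card + 1) (_hP : Tight (proj r F)) (_hr : ({r} : Finset α) ∈ F)
    (_hE : (∅ : Finset α) ∉ F) (_hb0 : ({b} : Finset α) ∉ F) (_hx0 : x ∈ part0 r F) (_hx1 : x ∉ partr r F)
    (_hbx : b ∉ x) (_hxb0 : insert b x ∈ part0 r F) (hxb1 : insert b x ∈ partr r F)
    (_hL : ∀ e ∈ partner r F, insert b e ∉ partner r F) : b ≠ r := by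
  rintro rfl
  exact (mem_partr.1 hxb1).1 (mem_insert_self b x)

omit [Fintype α] in
/-- The witness condition: `x` and `insert b x` are not both partner members. -/
theorem hwit (_hF : (F \\ F).card = F.card + 1) (_hP : Tight (proj r F)) (_hr : ({r} : Finset α) ∈ F)
    (_hE : (∅ : Finset α) ∉ F) (_hb0 : ({b} : Finset α) ∉ F) (_hx0 : x ∈ part0 r F) (hx1 : x ∉ partr r F)
    (_hbx : b ∉ x) (_hxb0 : insert b x ∈ part0 r F) (_hxb1 : insert b x ∈ partr r F)
    (_hL : ∀ e ∈ partner r F, insert b e ∉ partner r F) : ¬ (x ∈ partr r F ∧ insert b x ∈ part0 r F) :=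
  fun h => hx1 h.1

/-- `Λ_b = {∅}`. -/
theorem hlam (hF : (F \\ F).card = F.card + 1) (hP : Tight (proj r F)) (hr : ({r} : Finset α) ∈ F)
    (_hE : (∅ : Finset α) ∉ F) (_hb0 : ({b} : Finset α) ∉ F) (hx0 : x ∈ part0 r F) (_hx1 : x ∉ partr r F)
    (hbx : b ∉ x) (_hxb0 : insert b x ∈ part0 r F) (hxb1 : insert b x ∈ partr r F)
    (hL : ∀ e ∈ partner r F, insert b e ∉ partner r F) : ((diffsY r F).filter fun y => b ∉ y ∧ insert b y ∈ diffsY r F) = {∅} :=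
  lam_eq_singleton_empty_of_no_partner_pair hF hP hr hx0 hbx hxb1 hL

/-- `Λ_b = {∅}` in usable form: `y ∈ Y`, `b ∉ y`, `insert b y ∈ Y` force `y = ∅`. -/
theorem eq_empty_of_mem_lam (hF : (F \\ F).card = F.card + 1) (hP : Tight (proj r F)) (hr : ({r} : Finset α) ∈ F)
    (hE : (∅ : Finset α) ∉ F) (hb0 : ({b} : Finset α) ∉ F) (hx0 : x ∈ part0 r F) (hx1 : x ∉ partr r F)
    (hbx : b ∉ x) (hxb0 : insert b x ∈ part0 r F) (hxb1 : insert b x ∈ partr r F)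
    (hL : ∀ e ∈ partner r F, insert b e ∉ partner r F) {y : Finset α} (hy : y ∈ diffsY r F) (hby : b ∉ y)
    (hyb : insert b y ∈ diffsY r F) : y = ∅ := by
  have : y ∈ ((diffsY r F).filter fun y => b ∉ y ∧ insert b y ∈ diffsY r F) :=
    mem_filter.2 ⟨hy, hby, hyb⟩
  rw [(hlam hF hP hr hE hb0 hx0 hx1 hbx hxb0 hxb1 hL), mem_singleton] at this
  exact this

/-- (W2′ a) at the witness: every `b`-pair of the trace is an `F₀`-pair or an `F₁`-pair. -/
theorem pair_or (hF : (F \\ F).card = F.card + 1) (hP : Tight (proj r F)) (hr : ({r} : Finset α) ∈ F)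
    (hE : (∅ : Finset α) ∉ F) (hb0 : ({b} : Finset α) ∉ F) (hx0 : x ∈ part0 r F) (hx1 : x ∉ partr r F)
    (hbx : b ∉ x) (hxb0 : insert b x ∈ part0 r F) (hxb1 : insert b x ∈ partr r F)
    (hL : ∀ e ∈ partner r F, insert b e ∉ partner r F) {e : Finset α} (he : e ∈ proj r F) (hbe : b ∉ e) (heb : insert b e ∈ proj r F) :
    (e ∈ part0 r F ∧ insert b e ∈ part0 r F) ∨ (e ∈ partr r F ∧ insert b e ∈ partr r F) :=
  pair_mem_part0_or_partr_of_witness hF hP hr hx0 hbx hxb1 (hwit hF hP hr hE hb0 hx0 hx1 hbx hxb0 hxb1 hL) he hbe heb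

/-- (W2′ c) at the witness: every face `e ∌ b` is `r`-lifted or has `insert b e` `r`-lifted. -/
theorem lift_or (hF : (F \\ F).card = F.card + 1) (hP : Tight (proj r F)) (hr : ({r} : Finset α) ∈ F)
    (hE : (∅ : Finset α) ∉ F) (hb0 : ({b} : Finset α) ∉ F) (hx0 : x ∈ part0 r F) (hx1 : x ∉ partr r F)
    (hbx : b ∉ x) (hxb0 : insert b x ∈ part0 r F) (hxb1 : insert b x ∈ partr r F)
    (hL : ∀ e ∈ partner r F, insert b e ∉ partner r F) {e : Finset α} (he : e ∈ proj r F) (hbe : b ∉ e) :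
    e ∈ partr r F ∨ insert b e ∈ partr r F :=
  mem_partr_or_insert_mem_partr_of_witness hF hP hr hE hb0 hx0 hbx hxb1 (hwit hF hP hr hE hb0 hx0 hx1 hbx hxb0 hxb1 hL)
    he hbe

omit [Fintype α] in
/-- `∅ ∈ F₁` (as `{r} ∈ F`). -/
theorem empty_mem_partr (_hF : (F \\ F).card = F.card + 1) (_hP : Tight (proj r F)) (hr : ({r} : Finset α) ∈ F)
    (_hE : (∅ : Finset α) ∉ F) (_hb0 : ({b} : Finset α) ∉ F) (_hx0 : x ∈ part0 r F) (_hx1 : x ∉ partr r F)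
    (_hbx : b ∉ x) (_hxb0 : insert b x ∈ part0 r F) (_hxb1 : insert b x ∈ partr r F)
    (_hL : ∀ e ∈ partner r F, insert b e ∉ partner r F) : (∅ : Finset α) ∈ partr r F :=
  mem_partr.2 ⟨notMem_empty r, by simpa using hr⟩

omit [Fintype α] in
/-- `x` is a face of the trace. -/
theorem x_mem_proj (_hF : (F \\ F).card = F.card + 1) (_hP : Tight (proj r F)) (_hr : ({r} : Finset α) ∈ F)
    (_hE : (∅ : Finset α) ∉ F) (_hb0 : ({b} : Finset α) ∉ F) (hx0 : x ∈ part0 r F) (_hx1 : x ∉ partr r F)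
    (_hbx : b ∉ x) (_hxb0 : insert b x ∈ part0 r F) (_hxb1 : insert b x ∈ partr r F)
    (_hL : ∀ e ∈ partner r F, insert b e ∉ partner r F) : x ∈ proj r F := by
  rw [proj_eq_union]; exact mem_union_left _ hx0

omit [Fintype α] in
/-- `insert b x` is a face of the trace. -/
theorem xb_mem_proj (_hF : (F \\ F).card = F.card + 1) (_hP : Tight (proj r F)) (_hr : ({r} : Finset α) ∈ F)
    (_hE : (∅ : Finset α) ∉ F) (_hb0 : ({b} : Finset α) ∉ F) (_hx0 : x ∈ part0 r F) (_hx1 : x ∉ partr r F)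
    (_hbx : b ∉ x) (_hxb0 : insert b x ∈ part0 r F) (hxb1 : insert b x ∈ partr r F)
    (_hL : ∀ e ∈ partner r F, insert b e ∉ partner r F) : insert b x ∈ proj r F := by
  rw [proj_eq_union]; exact mem_union_right _ hxb1

/-- `{b} = insert b x \ x` is a face of the trace. -/
theorem singleton_b_mem_proj (hF : (F \\ F).card = F.card + 1) (hP : Tight (proj r F)) (hr : ({r} : Finset α) ∈ F)
    (hE : (∅ : Finset α) ∉ F) (hb0 : ({b} : Finset α) ∉ F) (hx0 : x ∈ part0 r F) (hx1 : x ∉ partr r F)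
    (hbx : b ∉ x) (hxb0 : insert b x ∈ part0 r F) (hxb1 : insert b x ∈ partr r F)
    (hL : ∀ e ∈ partner r F, insert b e ∉ partner r F) : ({b} : Finset α) ∈ proj r F := by
  have h := sdiff_mem_proj_of_tight hP hr (xb_mem_proj hF hP hr hE hb0 hx0 hx1 hbx hxb0 hxb1 hL) (x_mem_proj hF hP hr hE hb0 hx0 hx1 hbx hxb0 hxb1 hL)
  rwa [Finset.insert_sdiff_of_notMem x hbx, sdiff_self] at h

omit [Fintype α] in
/-- `x ≠ ∅` (as `∅ ∈ F₁` and `x ∉ F₁`). -/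
theorem x_ne_empty (hF : (F \\ F).card = F.card + 1) (hP : Tight (proj r F)) (hr : ({r} : Finset α) ∈ F)
    (hE : (∅ : Finset α) ∉ F) (hb0 : ({b} : Finset α) ∉ F) (hx0 : x ∈ part0 r F) (hx1 : x ∉ partr r F)
    (hbx : b ∉ x) (hxb0 : insert b x ∈ part0 r F) (hxb1 : insert b x ∈ partr r F)
    (hL : ∀ e ∈ partner r F, insert b e ∉ partner r F) : x ≠ ∅ := by
  intro h; exact hx1 (h ▸ (empty_mem_partr hF hP hr hE hb0 hx0 hx1 hbx hxb0 hxb1 hL))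

/-- **Step (2), first half.** A partnerless member `p ∋ b` has `x ⊊ p.erase b`, and `p \ x` is
again a partnerless member containing `b`. -/
theorem step_two_aux (hF : (F \\ F).card = F.card + 1) (hP : Tight (proj r F)) (hr : ({r} : Finset α) ∈ F)
    (hE : (∅ : Finset α) ∉ F) (hb0 : ({b} : Finset α) ∉ F) (hx0 : x ∈ part0 r F) (hx1 : x ∉ partr r F)
    (hbx : b ∉ x) (hxb0 : insert b x ∈ part0 r F) (hxb1 : insert b x ∈ partr r F)
    (hL : ∀ e ∈ partner r F, insert b e ∉ partner r F) {p : Finset α} (hp0 : p ∈ part0 r F) (hp1 : p ∉ partr r F) (hbp : b ∈ p) :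
    x ⊆ p.erase b ∧ x ≠ p.erase b ∧ p \ x ∈ part0 r F ∧ p \ x ∉ partr r F ∧ b ∈ p \ x := by
  set q := p.erase b with hq
  have hpq : p = insert b q := (insert_erase hbp).symm
  have hpP : p ∈ proj r F := by rw [proj_eq_union]; exact mem_union_left _ hp0
  have hqP : q ∈ proj r F := by
    have h := sdiff_mem_proj_of_tight hP hr hpP (singleton_b_mem_proj hF hP hr hE hb0 hx0 hx1 hbx hxb0 hxb1 hL)
    rwa [sdiff_singleton_eq_erase] at h
  have hbq : b ∉ q := notMem_erase b p
  -- `q ∈ K`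
  have hq1 : q ∈ partr r F := by
    rcases (lift_or hF hP hr hE hb0 hx0 hx1 hbx hxb0 hxb1 hL) hqP hbq with h | h
    · exact h
    · exact absurd (hpq ▸ h) hp1
  have hq0 : q ∈ part0 r F := by
    rcases (pair_or hF hP hr hE hb0 hx0 hx1 hbx hxb0 hxb1 hL) hqP hbq (hpq ▸ hpP) with h | h
    · exact h.1
    · exact absurd (hpq ▸ h.2) hp1
  -- `x ⊆ q`
  have hxq : x ⊆ q := by
    have h1 : insert b x \ q ∈ diffsY r F := sdiff_mem_diffs hxb1 hq0
    rw [Finset.insert_sdiff_of_notMem x hbq] at h1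
    have h2 : insert b x \ p ∈ diffsY r F := sdiff_mem_diffs hxb1 hp0
    rw [hpq, insert_sdiff_insert_of_notMem hbx] at h2
    have := (eq_empty_of_mem_lam hF hP hr hE hb0 hx0 hx1 hbx hxb0 hxb1 hL) h2 (fun h => hbx (mem_sdiff.1 h).1) h1
    exact sdiff_eq_empty_iff_subset.1 this
  have hxq' : x ≠ q := fun h => hx1 (h ▸ hq1)
  -- `q \ x ∈ Y` is nonempty and avoids `b`, so `p \ x = insert b (q \ x) ∉ Y`
  have hqx : q \ x ∈ diffsY r F := sdiff_mem_diffs hq1 hx0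
  have hqxne : q \ x ≠ ∅ := by
    intro h
    exact hxq' (Finset.Subset.antisymm hxq (sdiff_eq_empty_iff_subset.1 h))
  have hpx_eq : p \ x = insert b (q \ x) := by
    rw [hpq, Finset.insert_sdiff_of_notMem q hbx]
  have hpxY : p \ x ∉ diffsY r F := by
    intro h
    rw [hpx_eq] at h
    exact hqxne ((eq_empty_of_mem_lam hF hP hr hE hb0 hx0 hx1 hbx hxb0 hxb1 hL) hqx (fun h' => hbq (mem_sdiff.1 h').1) h)
  -- the `b`-pair `(q \ x, p \ x)` is an `F₀`-pair
  have hqxP : q \ x ∈ proj r F := sdiff_mem_proj_of_tight hP hr hqP (x_mem_proj hF hP hr hE hb0 hx0 hx1 hbx hxb0 hxb1 hL)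
  have hpxP : p \ x ∈ proj r F := sdiff_mem_proj_of_tight hP hr hpP (x_mem_proj hF hP hr hE hb0 hx0 hx1 hbx hxb0 hxb1 hL)
  have hpx1 : p \ x ∉ partr r F := by
    intro h
    apply hpxY
    have h' := sdiff_mem_diffs h hx0
    have hss : (p \ x) \ x = p \ x := by ext a; simp only [mem_sdiff]; tauto
    rwa [hss] at h'
  have hpx0 : p \ x ∈ part0 r F := by
    rcases (pair_or hF hP hr hE hb0 hx0 hx1 hbx hxb0 hxb1 hL) hqxP (fun h => hbq (mem_sdiff.1 h).1) (hpx_eq ▸ hpxP) with h | h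
    · rw [hpx_eq]; exact h.2
    · exact absurd (hpx_eq ▸ h.2) hpx1
  exact ⟨hxq, hxq', hpx0, hpx1, mem_sdiff.2 ⟨hbp, hbx⟩⟩

/-- **Step (2).** `P₀ = {x}`: every member avoiding `r` without its `r`-partner is `x`. -/
theorem eq_x_of_partnerless (hF : (F \\ F).card = F.card + 1) (hP : Tight (proj r F)) (hr : ({r} : Finset α) ∈ F)
    (hE : (∅ : Finset α) ∉ F) (hb0 : ({b} : Finset α) ∉ F) (hx0 : x ∈ part0 r F) (hx1 : x ∉ partr r F)
    (hbx : b ∉ x) (hxb0 : insert b x ∈ part0 r F) (hxb1 : insert b x ∈ partr r F)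
    (hL : ∀ e ∈ partner r F, insert b e ∉ partner r F) {p : Finset α} (hp0 : p ∈ part0 r F) (hp1 : p ∉ partr r F) : p = x := by
  by_cases hbp : b ∈ p
  · exfalso
    obtain ⟨hxq, -, hpx0, hpx1, hbpx⟩ := (step_two_aux hF hP hr hE hb0 hx0 hx1 hbx hxb0 hxb1 hL) hp0 hp1 hbp
    obtain ⟨hxq', -, -, -, -⟩ := (step_two_aux hF hP hr hE hb0 hx0 hx1 hbx hxb0 hxb1 hL) hpx0 hpx1 hbpx
    -- `x ⊆ (p \ x).erase b ⊆ p \ x`, so `x = ∅`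
    have : x ⊆ p \ x := hxq'.trans (erase_subset b _)
    apply (x_ne_empty hF hP hr hE hb0 hx0 hx1 hbx hxb0 hxb1 hL)
    rw [eq_empty_iff_forall_notMem]
    intro a ha
    exact (mem_sdiff.1 (this ha)).2 ha
  · have hpP : p ∈ proj r F := by rw [proj_eq_union]; exact mem_union_left _ hp0
    have hpb1 : insert b p ∈ partr r F := by
      rcases (lift_or hF hP hr hE hb0 hx0 hx1 hbx hxb0 hxb1 hL) hpP hbp with h | h
      · exact absurd h hp1
      · exact h
    have hpbP : insert b p ∈ proj r F := by rw [proj_eq_union]; exact mem_union_right _ hpb1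
    have hpb0 : insert b p ∈ part0 r F := by
      rcases (pair_or hF hP hr hE hb0 hx0 hx1 hbx hxb0 hxb1 hL) hpP hbp hpbP with h | h
      · exact h.2
      · exact absurd h.1 hp1
    -- `x \ p ∈ Λ_b` and `p \ x ∈ Λ_b`
    have h1 : x \ p ∈ diffsY r F := by
      have h := sdiff_mem_diffs hxb1 hpb0
      rwa [insert_sdiff_insert_of_notMem hbx] at h
    have h2 : insert b (x \ p) ∈ diffsY r F := by
      rw [← Finset.insert_sdiff_of_notMem x hbp]; exact sdiff_mem_diffs hxb1 hp0
    have h3 : p \ x ∈ diffsY r F := by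
      have h := sdiff_mem_diffs hpb1 hxb0
      rwa [insert_sdiff_insert_of_notMem hbp] at h
    have h4 : insert b (p \ x) ∈ diffsY r F := by
      rw [← Finset.insert_sdiff_of_notMem p hbx]; exact sdiff_mem_diffs hpb1 hx0
    have e1 := (eq_empty_of_mem_lam hF hP hr hE hb0 hx0 hx1 hbx hxb0 hxb1 hL) h1 (fun h => hbx (mem_sdiff.1 h).1) h2
    have e2 := (eq_empty_of_mem_lam hF hP hr hE hb0 hx0 hx1 hbx hxb0 hxb1 hL) h3 (fun h => hbp (mem_sdiff.1 h).1) h4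
    exact Finset.Subset.antisymm (sdiff_eq_empty_iff_subset.1 e2) (sdiff_eq_empty_iff_subset.1 e1)

/-- A partner member `k ∋ b` is `insert b x`, or its `b`-deletion is an `r`-only member inside `x`
(inside every member of `F₀` avoiding `b`). -/
theorem partner_mem_b_cases (hF : (F \\ F).card = F.card + 1) (hP : Tight (proj r F)) (hr : ({r} : Finset α) ∈ F)
    (hE : (∅ : Finset α) ∉ F) (hb0 : ({b} : Finset α) ∉ F) (hx0 : x ∈ part0 r F) (hx1 : x ∉ partr r F)
    (hbx : b ∉ x) (hxb0 : insert b x ∈ part0 r F) (hxb1 : insert b x ∈ partr r F)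
    (hL : ∀ e ∈ partner r F, insert b e ∉ partner r F) {k : Finset α} (hk : k ∈ partner r F)
    (hbk : b ∈ k) :
    k = insert b x ∨ (k.erase b ∈ partr r F ∧ k.erase b ∉ part0 r F ∧
      ∀ s ∈ part0 r F, b ∉ s → k.erase b ⊆ s) := by
  set q := k.erase b with hq
  have hkq : k = insert b q := (insert_erase hbk).symm
  have hkP : k ∈ proj r F := by rw [proj_eq_union]; exact mem_union_left _ (mem_inter.1 hk).1
  have hqP : q ∈ proj r F := by
    have h := sdiff_mem_proj_of_tight hP hr hkP (singleton_b_mem_proj hF hP hr hE hb0 hx0 hx1 hbx hxb0 hxb1 hL)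
    rwa [sdiff_singleton_eq_erase] at h
  have hbq : b ∉ q := notMem_erase b k
  rcases (pair_or hF hP hr hE hb0 hx0 hx1 hbx hxb0 hxb1 hL) hqP hbq (hkq ▸ hkP) with h | h
  · left
    have hq1 : q ∉ partr r F := fun hq1 => hL q (mem_inter.2 ⟨h.1, hq1⟩) (hkq ▸ hk)
    rw [hkq, (eq_x_of_partnerless hF hP hr hE hb0 hx0 hx1 hbx hxb0 hxb1 hL) h.1 hq1]
  · right
    refine ⟨h.1, fun hq0 => hL q (mem_inter.2 ⟨hq0, h.1⟩) (hkq ▸ hk), ?_⟩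
    intro s hs hbs
    have h1 : q \ s ∈ diffsY r F := sdiff_mem_diffs h.1 hs
    have h2 : insert b (q \ s) ∈ diffsY r F := by
      rw [← Finset.insert_sdiff_of_notMem q hbs, ← hkq]
      exact sdiff_mem_diffs (mem_inter.1 hk).2 hs
    exact sdiff_eq_empty_iff_subset.1
      ((eq_empty_of_mem_lam hF hP hr hE hb0 hx0 hx1 hbx hxb0 hxb1 hL) h1 (fun h' => hbq (mem_sdiff.1 h').1) h2)

end A26Data

end UniquePartnerless

end PercRepro.MSTight
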